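import Literature.MathematicalPhysics.QuantumFieldTheory.ConformalBootstrap3D.CasimirPairStencilAB
import Literature.MathematicalPhysics.QuantumFieldTheory.ConformalBootstrap3D.MeanFieldCoefficientsAB
import Mathlib.Tactic
import HarnessLib

/-!
# Formal block expansions with unequal external dimensions and the `(a,b)` uniqueness engine

The `(a,b)` version of `MeanFieldFormalExpansion` (Hogervorst–Rychkov 2013 §3; Dolan–Osborn 2004 §3, 2011 §4.2;
`CasimirPairStencilAB`): arrays `X : ℤ → ℤ → ℝ`, `X M j` = coefficient of `𝒫_{2s+M, j}`, for a frame with base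
`2s` (for two generalised free fields of dimensions `p`, `q`: `s = (p+q)/2`). The double-twist block
`(Δ, ℓ) = (2s+2n+ℓ, ℓ)` with parameters `(a,b)` has the array `blockArrAB a b s n ℓ` = `A(a,b; 2s+2n+ℓ, ℓ)`
(`hrCoeffZAB`) placed at level `2n+ℓ`; a coefficient family `c : ℕ → ℕ → ℝ` defines the FORMAL BLOCK SUM
`blockSumAB a b s c = Σ_{n,ℓ} c n ℓ · blockArrAB a b s n ℓ` (a finite sum at each entry). Proved:

* `opLAB_blockSumAB` — the closure stencil `𝕃^{(a,b)}_s` acts on a formal block sum through the diagonal symbols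
  `ℓ_s(Δ,ℓ)` (`opLAB_hrCoeffZAB`; every block is strictly above the unitarity bound for `s > 1/2`);
* `ClosureRelAB a b s μ X Y :⟺ 𝕃^{(a,b)}_s X = μ · S² Y` — the closure relation from the frame `s` to `s + 1`
  with constant `μ`;
* `closureRelAB_blockSum` — coefficient families related by the twist recursion
  `c (n+1) ℓ · ℓ_s(2s+2n+2+ℓ, ℓ) = μ · c' n ℓ` give block sums in the closure relation; in particular the mixed
  mean-field families `ε_ℓ P_{n,ℓ}(p,q)/λ_ℓ` with `μ = μ(p,q) = -pq(2p-1)(2q-1)`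
  (`closureRelAB_blockSum_mft`, from `mftCoeffAB_succ`), for ANY `(a,b)` (the stencil parameters enter only the
  sources);
* `closureRelAB_delta` — the source array `δ` of `u^s` is in the closure relation with itself with constant
  `clTwoAB a b (2s) 0` (`= μ(p,q)` exactly for `{a,b} = {±(p-q)/2}` with `b = -a`, `clTwoAB_antidiag`);
* `eq_of_closureRelAB` — **the uniqueness engine**: two families `X_i`, `Y_i` (frames `s + i`) supported on
  `0 ≤ j ≤ M`, `M - j` even, satisfying the closure relations with the same constants and agreeing on the EDGE
  `j = M` are equal (level induction; pivot `ℓ_{s+i}(2(s+i)+M, j) ≠ 0` for `j ≤ M - 2`, `clDiag_ne_zero`).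

Finite algebra throughout. [cite: HogervorstRychkov2013, §3 eqs. (3.6)–(3.9)] [cite: DolanOsborn2011, §4.2]
[cite: DolanOsborn2004, §3 eqs. (3.9)–(3.12)]
-/

namespace Literature.MathematicalPhysics.QuantumFieldTheory.ConformalBootstrap3D

open Finset

/-! ### Block arrays and formal block sums in the frame `2s` -/

/-- The array of the double-twist block `(Δ,ℓ) = (2s+2n+ℓ, ℓ)` with parameters `(a,b)` in the frame with base
`2s`: `A(a,b;Δ,ℓ)` placed at level `2n + ℓ`. [cite: DolanOsborn2004, §3 eqs. (3.9)–(3.12)] -/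
noncomputable def blockArrAB (a b s : ℝ) (n ℓ : ℕ) : ℤ → ℤ → ℝ := fun M j =>
  hrCoeffZAB a b (2 * s + 2 * n + ℓ) ℓ (M - (2 * n + ℓ : ℕ)) j

/-- At `a = b = 0` this is `blockArr`. [folklore] -/
theorem blockArrAB_zero_zero (p : ℝ) (n ℓ : ℕ) : blockArrAB 0 0 p n ℓ = blockArr p n ℓ := by
  funext M j; simp only [blockArrAB, blockArr, hrCoeffZAB_zero_zero]

/-- A block array vanishes below its apex level `2n + ℓ`. [folklore] -/
theorem blockArrAB_eq_zero_of_lt (a b s : ℝ) {n ℓ : ℕ} {M : ℤ} (h : M < (2 * n + ℓ : ℕ)) (j : ℤ) :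
    blockArrAB a b s n ℓ M j = 0 :=
  hrCoeffZAB_of_neg_left _ _ _ _ (by omega) j

/-- A block array vanishes at negative spin. [folklore] -/
theorem blockArrAB_of_neg_right (a b s : ℝ) (n ℓ : ℕ) (M : ℤ) {j : ℤ} (hj : j < 0) :
    blockArrAB a b s n ℓ M j = 0 :=
  hrCoeffZAB_of_neg_right _ _ _ _ _ hj

/-- Support of a block array: `0 ≤ j ≤ M` and `M - j` even. [folklore] -/
theorem blockArrAB_eq_zero_of_not_supp (a b s : ℝ) (n ℓ : ℕ) {M j : ℤ}
    (h : ¬ (0 ≤ j ∧ j ≤ M ∧ Even (M - j))) : blockArrAB a b s n ℓ M j = 0 := by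
  unfold blockArrAB
  apply hrCoeffZAB_eq_zero_of_not_inRangeZ
  rintro ⟨hj, h1, h2, h3⟩
  apply h
  obtain ⟨k, hk⟩ := h3
  push_cast at hk h1 h2
  exact ⟨hj, by omega, ⟨k + n - j, by omega⟩⟩

/-- The block `(s, n+1, ℓ)` is the block `(s+1, n, ℓ)` shifted up by two levels. [folklore] -/
theorem blockArrAB_succ (a b s : ℝ) (n ℓ : ℕ) (M j : ℤ) :
    blockArrAB a b s (n + 1) ℓ M j = blockArrAB a b (s + 1) n ℓ (M - 2) j := by
  unfold blockArrAB
  have e1 : (2 * s + 2 * ((n + 1 : ℕ) : ℝ) + ℓ) = 2 * (s + 1) + 2 * (n : ℝ) + ℓ := by push_cast; ring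
  have e2 : M - ((2 * (n + 1) + ℓ : ℕ) : ℤ) = M - 2 - ((2 * n + ℓ : ℕ) : ℤ) := by push_cast; ring
  rw [e1, e2]

/-- **The formal block sum** of a coefficient family `c n ℓ` in the frame `2s` with parameters `(a,b)`:
`(Σ_{n,ℓ} c n ℓ · blockArrAB a b s n ℓ)_{M,j}`, a finite sum at each entry. [cite: HogervorstRychkov2013, §3] -/
noncomputable def blockSumAB (a b s : ℝ) (c : ℕ → ℕ → ℝ) : ℤ → ℤ → ℝ := fun M j =>
  ∑ n ∈ range (M.toNat + 1), ∑ ℓ ∈ range (M.toNat + 1), c n ℓ * blockArrAB a b s n ℓ M j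

/-- At `a = b = 0` this is `blockSum`. [folklore] -/
theorem blockSumAB_zero_zero (p : ℝ) (c : ℕ → ℕ → ℝ) : blockSumAB 0 0 p c = blockSum p c := by
  funext M j; simp only [blockSumAB, blockSum, blockArrAB_zero_zero]

/-- Enlarging the (finite) index range does not change a formal block sum. [folklore] -/
theorem blockSumAB_eq_sum_of_le (a b s : ℝ) (c : ℕ → ℕ → ℝ) {M : ℤ} {K : ℕ} (hK : M.toNat + 1 ≤ K) (j : ℤ) :
    blockSumAB a b s c M j = ∑ n ∈ range K, ∑ ℓ ∈ range K, c n ℓ * blockArrAB a b s n ℓ M j := by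
  unfold blockSumAB
  have hrow : ∀ n, ∑ ℓ ∈ range K, c n ℓ * blockArrAB a b s n ℓ M j =
      ∑ ℓ ∈ range (M.toNat + 1), c n ℓ * blockArrAB a b s n ℓ M j := by
    intro n
    apply eventually_constant_sum _ hK
    intro ℓ hℓ
    rw [blockArrAB_eq_zero_of_lt a b s (by omega) j, mul_zero]
  rw [eq_comm]
  calc ∑ n ∈ range K, ∑ ℓ ∈ range K, c n ℓ * blockArrAB a b s n ℓ M j
      = ∑ n ∈ range K, ∑ ℓ ∈ range (M.toNat + 1), c n ℓ * blockArrAB a b s n ℓ M j :=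
        sum_congr rfl fun n _ => hrow n
    _ = ∑ n ∈ range (M.toNat + 1), ∑ ℓ ∈ range (M.toNat + 1), c n ℓ * blockArrAB a b s n ℓ M j := by
        apply eventually_constant_sum _ hK
        intro n hn
        apply sum_eq_zero
        intro ℓ _
        rw [blockArrAB_eq_zero_of_lt a b s (by omega) j, mul_zero]

/-- Support of a formal block sum: `0 ≤ j ≤ M`, `M - j` even. [folklore] -/
theorem blockSumAB_eq_zero_of_not_supp (a b s : ℝ) (c : ℕ → ℕ → ℝ) {M j : ℤ}
    (h : ¬ (0 ≤ j ∧ j ≤ M ∧ Even (M - j))) : blockSumAB a b s c M j = 0 := by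
  unfold blockSumAB
  apply sum_eq_zero; intro n _; apply sum_eq_zero; intro ℓ _
  rw [blockArrAB_eq_zero_of_not_supp a b s n ℓ h, mul_zero]

/-- The edge of a formal block sum: only the leading-twist blocks `n = 0`, `ℓ ≤ M` reach the entry `(M, M)`,
`blockSumAB a b s c M M = Σ_{ℓ ≤ M} c 0 ℓ · A_{M-ℓ, M}(a,b; 2s+ℓ, ℓ)`. [cite: HogervorstRychkov2013, §3 eq. (3.5)] -/
theorem blockSumAB_edge (a b s : ℝ) (c : ℕ → ℕ → ℝ) (M : ℕ) :
    blockSumAB a b s c M M = ∑ ℓ ∈ range (M + 1), c 0 ℓ * hrCoeffAB a b (2 * s + ℓ) ℓ (M - ℓ) M := by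
  unfold blockSumAB
  rw [Int.toNat_natCast, sum_range_succ' (fun n => ∑ ℓ ∈ range (M + 1), c n ℓ * blockArrAB a b s n ℓ M M)]
  have hzero : ∑ n ∈ range M, ∑ ℓ ∈ range (M + 1), c (n + 1) ℓ * blockArrAB a b s (n + 1) ℓ M M = 0 := by
    apply sum_eq_zero; intro n _; apply sum_eq_zero; intro ℓ _
    unfold blockArrAB
    by_cases hlt : (M : ℤ) < ((2 * (n + 1) + ℓ : ℕ) : ℤ)
    · rw [hrCoeffZAB_of_neg_left _ _ _ _ (by omega), mul_zero]
    · obtain ⟨N, hN⟩ : ∃ N : ℕ, (M : ℤ) - ((2 * (n + 1) + ℓ : ℕ) : ℤ) = N := ⟨M - (2 * (n + 1) + ℓ), by omega⟩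
      rw [hN, hrCoeffZAB_natCast, hrCoeffAB_eq_zero_of_lt _ _ _ (by omega), mul_zero]
  rw [hzero, zero_add]
  refine sum_congr rfl fun ℓ hℓ => ?_
  rw [mem_range] at hℓ
  unfold blockArrAB
  have e : (M : ℤ) - ((2 * 0 + ℓ : ℕ) : ℤ) = ((M - ℓ : ℕ) : ℤ) := by push_cast; omega
  rw [e, hrCoeffZAB_natCast]
  congr 1
  push_cast; ring

/-! ### The closure stencil acts on formal block sums through the diagonal symbols -/

/-- `opLAB a b s (2s)` on a block array `(a,b,s,n,ℓ)` multiplies it by `ℓ_s(2s+2n+ℓ, ℓ)` (`s > 1/2`).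
[cite: DolanOsborn2011, §4.2] -/
theorem opLAB_blockArrAB {s : ℝ} (hs : 1 / 2 < s) (a b : ℝ) (n ℓ : ℕ) :
    opLAB a b s (2 * s) (blockArrAB a b s n ℓ) =
      fun M j => clDiag s (2 * s + 2 * n + ℓ) ℓ * blockArrAB a b s n ℓ M j := by
  unfold blockArrAB
  rw [opLAB_shift, show (2 * s + (((2 * n + ℓ : ℕ) : ℤ) : ℝ)) = 2 * s + 2 * (n : ℝ) + ℓ by push_cast; ring,
    opLAB_hrCoeffZAB a b (unitarityBound3D_lt_twist hs n ℓ) s]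

/-- **The closure stencil on a formal block sum**: `𝕃^{(a,b)}_s (Σ c_{n,ℓ} g_{n,ℓ}) = Σ ℓ_s(Δ_{n,ℓ},ℓ) c_{n,ℓ} g_{n,ℓ}`
at the level of coefficient arrays. [cite: DolanOsborn2011, §4.2] -/
theorem opLAB_blockSumAB {s : ℝ} (hs : 1 / 2 < s) (a b : ℝ) (c : ℕ → ℕ → ℝ) :
    opLAB a b s (2 * s) (blockSumAB a b s c) =
      blockSumAB a b s (fun n ℓ => clDiag s (2 * s + 2 * n + ℓ) ℓ * c n ℓ) := by
  funext M j
  set K := M.toNat + 1 with hK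
  have h0 : blockSumAB a b s c M j = ∑ n ∈ range K, ∑ ℓ ∈ range K, c n ℓ * blockArrAB a b s n ℓ M j :=
    blockSumAB_eq_sum_of_le a b s c le_rfl j
  have h1 : blockSumAB a b s c (M - 1) (j - 1) =
      ∑ n ∈ range K, ∑ ℓ ∈ range K, c n ℓ * blockArrAB a b s n ℓ (M - 1) (j - 1) :=
    blockSumAB_eq_sum_of_le a b s c (by omega) _
  have h2 : blockSumAB a b s c (M - 1) (j + 1) =
      ∑ n ∈ range K, ∑ ℓ ∈ range K, c n ℓ * blockArrAB a b s n ℓ (M - 1) (j + 1) :=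
    blockSumAB_eq_sum_of_le a b s c (by omega) _
  have h3 : blockSumAB a b s c (M - 2) j = ∑ n ∈ range K, ∑ ℓ ∈ range K, c n ℓ * blockArrAB a b s n ℓ (M - 2) j :=
    blockSumAB_eq_sum_of_le a b s c (by omega) _
  have hR : blockSumAB a b s (fun n ℓ => clDiag s (2 * s + 2 * n + ℓ) ℓ * c n ℓ) M j =
      ∑ n ∈ range K, ∑ ℓ ∈ range K, clDiag s (2 * s + 2 * n + ℓ) ℓ * c n ℓ * blockArrAB a b s n ℓ M j :=
    blockSumAB_eq_sum_of_le a b s _ le_rfl j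
  have hterm : ∀ n ℓ : ℕ, clDiag s (2 * s + 2 * n + ℓ) ℓ * c n ℓ * blockArrAB a b s n ℓ M j =
      c n ℓ * opLAB a b s (2 * s) (blockArrAB a b s n ℓ) M j := by
    intro n ℓ; rw [opLAB_blockArrAB hs]; ring
  simp only [opLAB] at hterm ⊢
  rw [h0, h1, h2, h3, hR, mul_sum, mul_sum, mul_sum, mul_sum, ← sum_add_distrib, ← sum_add_distrib,
    ← sum_add_distrib]
  refine sum_congr rfl fun n _ => ?_
  rw [mul_sum, mul_sum, mul_sum, mul_sum, ← sum_add_distrib, ← sum_add_distrib, ← sum_add_distrib]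
  refine sum_congr rfl fun ℓ _ => ?_
  rw [hterm]; ring

/-! ### The closure relation -/

/-- **The `(a,b)` closure relation** with constant `μ` between an array `X` in the frame `s` and an array `Y`
in the frame `s + 1`: `𝕃^{(a,b)}_s X = μ · S² Y` (`S²` = shift by two levels, i.e. multiplication by `u = z z̄`).
[cite: DolanOsborn2011, §4.2] -/
def ClosureRelAB (a b s μ : ℝ) (X Y : ℤ → ℤ → ℝ) : Prop :=
  ∀ M j : ℤ, opLAB a b s (2 * s) X M j = μ * Y (M - 2) j

/-- At `a = b = 0`, `μ = μ(p)` this is `ClosureRel p`. [folklore] -/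
theorem closureRelAB_zero_zero_iff (p : ℝ) (X Y : ℤ → ℤ → ℝ) :
    ClosureRelAB 0 0 p (mftMu p) X Y ↔ ClosureRel p X Y := by
  unfold ClosureRelAB ClosureRel
  simp only [opLAB_zero_zero]

/-- The closure relation is linear (differences). [folklore] -/
theorem ClosureRelAB.sub {a b s μ : ℝ} {X Y X' Y' : ℤ → ℤ → ℝ} (h : ClosureRelAB a b s μ X Y)
    (h' : ClosureRelAB a b s μ X' Y') :
    ClosureRelAB a b s μ (fun M j => X M j - X' M j) (fun M j => Y M j - Y' M j) := by
  intro M j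
  rw [opLAB_sub]
  simp only [h M j, h' M j]
  ring

/-- **Block sums in the closure relation.** If the coefficient families `c` (frame `s`) and `c'` (frame `s+1`)
satisfy the twist recursion `c (n+1) ℓ · ℓ_s(2s+2n+2+ℓ, ℓ) = μ · c' n ℓ`, then
`𝕃^{(a,b)}_s (blockSumAB a b s c) = μ S² (blockSumAB a b (s+1) c')`: the leading twist `n = 0` drops out (`ℓ_s`
vanishes there) and the block `(s, n+1, ℓ)` is the block `(s+1, n, ℓ)` shifted by two levels.
[cite: DolanOsborn2011, §4.2] -/
theorem closureRelAB_blockSum {s : ℝ} (hs : 1 / 2 < s) (a b μ : ℝ) {c c' : ℕ → ℕ → ℝ}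
    (hrec : ∀ n ℓ, c (n + 1) ℓ * clDiag s (2 * s + 2 * ((n : ℝ) + 1) + ℓ) ℓ = μ * c' n ℓ) :
    ClosureRelAB a b s μ (blockSumAB a b s c) (blockSumAB a b (s + 1) c') := by
  intro M j
  rw [opLAB_blockSumAB hs]
  set K := M.toNat + 3 with hK
  rw [blockSumAB_eq_sum_of_le a b s _ (show M.toNat + 1 ≤ K by omega),
    blockSumAB_eq_sum_of_le a b (s + 1) c' (show (M - 2).toNat + 1 ≤ M.toNat + 2 by omega),
    show K = (M.toNat + 2) + 1 by omega, sum_range_succ']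
  -- leading twist: `clDiag s (2s + 0 + ℓ) ℓ = 0`
  have hlead : ∑ ℓ ∈ range (M.toNat + 2 + 1),
      clDiag s (2 * s + 2 * ((0 : ℕ) : ℝ) + ℓ) ℓ * c 0 ℓ * blockArrAB a b s 0 ℓ M j = 0 := by
    apply sum_eq_zero; intro ℓ _
    rw [show 2 * s + 2 * ((0 : ℕ) : ℝ) + ℓ = 2 * s + ℓ by push_cast; ring, clDiag_leading]; ring
  rw [hlead, add_zero, mul_sum]
  refine sum_congr rfl fun n _ => ?_
  rw [sum_range_succ _ (M.toNat + 2),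
    blockArrAB_eq_zero_of_lt a b s (show M < ((2 * (n + 1) + (M.toNat + 2) : ℕ) : ℤ) by omega), mul_zero,
    add_zero, mul_sum]
  refine sum_congr rfl fun ℓ _ => ?_
  rw [show (2 * s + 2 * ((n + 1 : ℕ) : ℝ) + ℓ) = 2 * s + 2 * ((n : ℝ) + 1) + ℓ by push_cast; ring,
    show clDiag s (2 * s + 2 * ((n : ℝ) + 1) + ℓ) ℓ * c (n + 1) ℓ * blockArrAB a b s (n + 1) ℓ M j =
      (c (n + 1) ℓ * clDiag s (2 * s + 2 * ((n : ℝ) + 1) + ℓ) ℓ) * blockArrAB a b s (n + 1) ℓ M j by ring,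
    hrec, blockArrAB_succ]
  ring

/-- **The mixed mean-field coefficient families are in the twist recursion**: with
`c_{p,q} n ℓ = ε_ℓ P_{n,ℓ}(p,q) / λ_ℓ` (any fixed sign pattern `ε ℓ`), `s = (p+q)/2`,
`c_{p,q} (n+1) ℓ · ℓ_s(2s+2n+2+ℓ, ℓ) = μ(p,q) · c_{p+1,q+1} n ℓ` (`mftCoeffAB_succ`). [cite: FitzpatrickKaplan2012, §2.2] -/
theorem mftAB_twist_rec {p q : ℝ} (hp : 1 / 2 < p) (hq : 1 / 2 < q) (ε : ℕ → ℝ) (n ℓ : ℕ) :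
    ε ℓ * mftCoeffAB p q (n + 1) ℓ / legendreLam ℓ *
        clDiag ((p + q) / 2) (2 * ((p + q) / 2) + 2 * ((n : ℝ) + 1) + ℓ) ℓ =
      mftMuAB p q * (ε ℓ * mftCoeffAB (p + 1) (q + 1) n ℓ / legendreLam ℓ) := by
  rw [mftCoeffAB_succ hp hq, mftMuAB]
  have hn : (0 : ℝ) ≤ n := Nat.cast_nonneg n
  have hℓ : (0 : ℝ) ≤ ℓ := Nat.cast_nonneg ℓ
  have h3 : (0 : ℝ) < (n : ℝ) + p + q - 1 := by linarith
  have h4 : (0 : ℝ) < 2 * (ℓ : ℝ) + 2 * n + 2 * p + 2 * q - 1 := by linarith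
  set D : ℝ := ((n : ℝ) + 1) * (2 * ℓ + 2 * n + 3) * (n + p + q - 1) * (2 * ℓ + 2 * n + 2 * p + 2 * q - 1)
    with hDdef
  have hD : D ≠ 0 := by rw [hDdef]; positivity
  have key : clDiag ((p + q) / 2) (2 * ((p + q) / 2) + 2 * ((n : ℝ) + 1) + ℓ) ℓ = -D := by
    rw [hDdef]; unfold clDiag; ring
  rw [key]
  calc ε ℓ * (p * q * (2 * p - 1) * (2 * q - 1) / D * mftCoeffAB (p + 1) (q + 1) n ℓ) / legendreLam ℓ * -D
      = -(p * q * (2 * p - 1) * (2 * q - 1) * (D / D)) *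
          (ε ℓ * mftCoeffAB (p + 1) (q + 1) n ℓ / legendreLam ℓ) := by ring
    _ = -(p * q * (2 * p - 1) * (2 * q - 1)) * (ε ℓ * mftCoeffAB (p + 1) (q + 1) n ℓ / legendreLam ℓ) := by
        rw [div_self hD, mul_one]

/-- **The mixed mean-field block sums are in the closure relation** (frame `(p+q)/2` to frame `(p+q)/2 + 1`,
constant `μ(p,q)`), for any fixed sign pattern `ε ℓ` and ANY stencil parameters `(a,b)`.
[cite: FitzpatrickKaplan2012, §2.2] -/
theorem closureRelAB_blockSum_mft {p q : ℝ} (hp : 1 / 2 < p) (hq : 1 / 2 < q) (a b : ℝ) (ε : ℕ → ℝ) :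
    ClosureRelAB a b ((p + q) / 2) (mftMuAB p q)
      (blockSumAB a b ((p + q) / 2) (fun n ℓ => ε ℓ * mftCoeffAB p q n ℓ / legendreLam ℓ))
      (blockSumAB a b ((p + q) / 2 + 1) (fun n ℓ => ε ℓ * mftCoeffAB (p + 1) (q + 1) n ℓ / legendreLam ℓ)) :=
  closureRelAB_blockSum (by linarith) a b (mftMuAB p q) fun n ℓ => mftAB_twist_rec hp hq ε n ℓ

/-! ### The source array of `u^s` -/

/-- **`u^s` is in the `(a,b)` closure relation with `u^{s+1}`** with constant `clTwoAB a b (2s) 0`: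
`𝕃^{(a,b)}_s 𝒫_{2s,0} = clTwoAB a b (2s) 0 · 𝒫_{2s+2,0}` (the coefficients of `𝒫_{2s,0}`, `𝒫_{2s+1,1}` vanish:
`clDiag s (2s) 0 = clUpAB a b s (2s) 0 = 0`). [cite: DolanOsborn2011, §4.2] -/
theorem closureRelAB_delta (a b s : ℝ) : ClosureRelAB a b s (clTwoAB a b (2 * s) 0) deltaArr deltaArr := by
  intro M j
  have hdiag : clDiag s (2 * s) 0 = 0 := by unfold clDiag; ring
  have hup : clUpAB a b s (2 * s) 0 = 0 := by unfold clUpAB; ring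
  simp only [opLAB, deltaArr]
  rcases (by omega : M = 0 ∨ M = 1 ∨ M = 2 ∨ (M ≠ 0 ∧ M ≠ 1 ∧ M ≠ 2)) with h0 | h1 | h2 | hne
  · subst h0
    by_cases hj : j = 0
    · subst hj; simp [hdiag]
    · simp [hj]
  · subst h1
    by_cases hj : j = 1
    · subst hj; norm_num [hup]
    · by_cases hj' : j = -1
      · subst hj'; norm_num
      · have e1 : ¬ (j - 1 = 0) := by omega
        have e2 : ¬ (j + 1 = 0) := by omega
        simp [e1, e2]
  · subst h2
    by_cases hj : j = 0
    · subst hj; norm_num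
    · simp [hj]
  · obtain ⟨h0, h1, h2⟩ := hne
    have e1 : ¬ (M - 1 = 0) := by omega
    have e2 : ¬ (M - 2 = 0) := by omega
    simp [h0, e1, e2]

/-- **The closure constant of `u^s` for the antidiagonal parameters is `μ(p,q)`**: with `s = (p+q)/2` and
`(a,b) = ((q-p)/2, (p-q)/2)` (the typed `g^{Δ_σε,Δ_σε}` family of `⟨σεσε⟩`, `Δ_σε = p - q`),
`clTwoAB a b (2s) 0 = -(2s+2a)(2s+2b)(2s-1+2a)(2s-1+2b)/4 = -pq(2p-1)(2q-1)`. [folklore] -/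
theorem clTwoAB_antidiag (p q : ℝ) :
    clTwoAB ((q - p) / 2) ((p - q) / 2) (2 * ((p + q) / 2)) 0 = mftMuAB p q := by
  unfold clTwoAB mftMuAB; ring

/-- The same for the opposite antidiagonal pair `((p-q)/2, (q-p)/2)`. [folklore] -/
theorem clTwoAB_antidiag' (p q : ℝ) :
    clTwoAB ((p - q) / 2) ((q - p) / 2) (2 * ((p + q) / 2)) 0 = mftMuAB p q := by
  unfold clTwoAB mftMuAB; ring

/-- **`u^s` in the closure relation with constant `μ(p,q)`** for the `⟨σεσε⟩` parameters. [cite: DolanOsborn2011, §4.2] -/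
theorem closureRelAB_delta_mft (p q : ℝ) :
    ClosureRelAB ((q - p) / 2) ((p - q) / 2) ((p + q) / 2) (mftMuAB p q) deltaArr deltaArr := by
  have h := closureRelAB_delta ((q - p) / 2) ((p - q) / 2) ((p + q) / 2)
  rwa [clTwoAB_antidiag] at h

/-! ### The uniqueness engine -/

/-- **Uniqueness from the closure relations, the support and the edge** (`(a,b)` version). Let `X i`, `Y i`
(`i ∈ ℕ`) be arrays in the frames `s + i` (`s > 1/2`), supported on `0 ≤ j ≤ M`, `M - j` even, each family
satisfying the closure relations `𝕃^{(a,b)}_{s+i} X_i = μ_i S² X_{i+1}` (same `a, b, μ_i` for `Y`), and agreeing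
on the edge `j = M`. Then `X i = Y i` for all `i`. Proof: the differences satisfy the same relations with zero
edge; by induction on the level, at `(M, j)` with `j ≤ M - 2` the relation reads
`ℓ_{s+i}(2(s+i)+M, j) E_i(M,j) + (lower levels) = μ_i E_{i+1}(M-2, j)`, and `ℓ_{s+i} ≠ 0` there (`clDiag_ne_zero`).
[cite: DolanOsborn2011, §4.2] -/
theorem eq_of_closureRelAB {s : ℝ} (hs : 1 / 2 < s) (a b : ℝ) (μ : ℕ → ℝ) (X Y : ℕ → ℤ → ℤ → ℝ)
    (hX : ∀ i : ℕ, ClosureRelAB a b (s + i) (μ i) (X i) (X (i + 1)))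
    (hY : ∀ i : ℕ, ClosureRelAB a b (s + i) (μ i) (Y i) (Y (i + 1)))
    (hXs : ∀ i M j, ¬ (0 ≤ j ∧ j ≤ M ∧ Even (M - j)) → X i M j = 0)
    (hYs : ∀ i M j, ¬ (0 ≤ j ∧ j ≤ M ∧ Even (M - j)) → Y i M j = 0)
    (hedge : ∀ i (M : ℤ), X i M M = Y i M M) :
    ∀ i, X i = Y i := by
  -- differences
  set E : ℕ → ℤ → ℤ → ℝ := fun i M j => X i M j - Y i M j with hE
  have hEc : ∀ i : ℕ, ClosureRelAB a b (s + i) (μ i) (E i) (E (i + 1)) := fun i => (hX i).sub (hY i)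
  have hEs : ∀ (i : ℕ) (M j : ℤ), ¬ (0 ≤ j ∧ j ≤ M ∧ Even (M - j)) → E i M j = 0 := by
    intro i M j h; simp only [hE, hXs i M j h, hYs i M j h, sub_zero]
  have hEe : ∀ (i : ℕ) (M : ℤ), E i M M = 0 := by
    intro i M; simp only [hE, hedge i M, sub_self]
  -- induction on the level
  have main : ∀ N : ℕ, ∀ (i : ℕ) (M j : ℤ), M ≤ N → E i M j = 0 := by
    intro N
    induction N with
    | zero =>
      intro i M j hM
      by_cases h : 0 ≤ j ∧ j ≤ M ∧ Even (M - j)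
      · have hM0 : M = 0 := by push_cast at hM; omega
        have hj0 : j = 0 := by omega
        subst hM0; subst hj0
        exact hEe i 0
      · exact hEs i M j h
    | succ N ih =>
      intro i M j hM
      by_cases hle : M ≤ N
      · exact ih i M j hle
      have hMN : M = N + 1 := by push_cast at hM; omega
      by_cases h : 0 ≤ j ∧ j ≤ M ∧ Even (M - j)
      swap
      · exact hEs i M j h
      obtain ⟨hj, hjM, hpar⟩ := h
      by_cases hjM' : j = M
      · subst hjM'; exact hEe i j
      have hj2 : j + 2 ≤ M := by
        obtain ⟨k, hk⟩ := hpar; omega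
      -- the closure relation at `(M, j)`
      have hc := hEc i M j
      simp only [opLAB] at hc
      rw [ih i (M - 1) (j - 1) (by omega), ih i (M - 1) (j + 1) (by omega), ih i (M - 2) j (by omega),
        ih (i + 1) (M - 2) j (by omega)] at hc
      have hc' : clDiag (s + i) (2 * (s + i) + (M : ℝ)) j * E i M j = 0 := by
        have := hc; push_cast at this ⊢; linarith
      have hsi : 1 / 2 < s + i := by have : (0 : ℝ) ≤ i := Nat.cast_nonneg i; linarith
      rcases mul_eq_zero.mp hc' with h0 | h0
      · exact absurd h0 (clDiag_ne_zero hsi hj hj2 hpar)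
      · exact h0
  intro i
  funext M j
  have := main (M.toNat) i M j (by omega)
  simp only [hE] at this
  linarith

end Literature.MathematicalPhysics.QuantumFieldTheory.ConformalBootstrap3D
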